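/-
Origin: expansion seat `planner-pub-hodgecm-prl1-g3-0`, handover #4 2026-08-18T05:59:02Z (`HOME/pub-hodgecm-prl1-g3/lean/Prl1g3/KoopmanUnitary.lean`, md5 af24a2c5, 130 lines);
landed by the gen-6 packager in gate run 24 as `HodgeCM/Automorphic/KoopmanUnitary.lean` (import ^import Prl1g3\.→import HodgeCM.Automorphic. ×1).
-/
/-
Origin: HOME/pub-hodgecm-prl1-g3/lean/Prl1g3/KoopmanUnitary.lean — session planner-pub-hodgecm-prl1-g3-0
(unit pub-hodgecm-prl1-g3, EXPANSION PROVER a-1 gen 3: CONSTRUCT the realisation).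
Intended final place (packager's call): `HodgeCM/Automorphic/KoopmanUnitary.lean`; module rename
`Prl1g3.DiscreteDecomposition` ↦ `HodgeCM.Automorphic.DiscreteDecomposition` (mine, handed over before this file).
NEW, ADDITIVE; touches no existing file.

KIND: KERNEL (pure Mathlib, nothing cited, nothing posited).
-/
import Summits.HodgeConjecture.HodgeCM.Automorphic.DiscreteDecomposition
import Mathlib.MeasureTheory.Function.LpSpace.DomAct.Basic
import Mathlib.MeasureTheory.Function.L2Space
import Mathlib.Topology.Algebra.Constructions.DomMulAct

set_option autoImplicit false

/-!
# The right regular representation on `L²` of an invariant measure is unitary — PROVED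

The first core hypothesis `RepCoreCarrier.Analytic(K).R_unitary` ("`R` is unitary: right Haar invariance on the
compact quotient `[U(W)]`", PerL v5 ll. 382–383) is the DEFINITION of the `L²` inner product plus invariance of the
measure.  Here it is discharged in the kernel for the honest model of `L²([U(W)])`: `H := Lp ℂ 2 μ` for a measure
`μ` on a measurable space `X` invariant under an action of a monoid/group `M` (Mathlib `SMulInvariantMeasure`), with
`R` the Koopman (translation) representation of `Mᵈᵐᵃ` (`(mk c • f)(x) = f(c • x)`, Mathlib `DomMulAct`).

* `RepDecomp.koopmanₗᵢ c : Lp ℂ 2 μ →ₗᵢ[ℂ] Lp ℂ 2 μ` and the representation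
  `RepDecomp.koopman : Mᵈᵐᵃ →* (Lp ℂ 2 μ →L[ℂ] Lp ℂ 2 μ)`;
* `RepDecomp.isUnitaryRep_koopman : IsUnitaryRep koopman` (KERNEL: a linear isometry preserves inner products);
* `RepCoreCarrier.AnalyticL2` — for a core carrier whose `H` IS `Lp ℂ 2 μ` and whose `R` IS `koopman`, the analytic
  hypotheses shrink to `{compactApprox, hatτ_complete}`; `AnalyticL2.toAnalyticK`, `AnalyticL2.toAnalytic`.
-/

noncomputable section

open scoped InnerProductSpace ENNReal
open MeasureTheory

namespace HodgeCM
namespace RepDecomp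

open HodgeCM.PerL34 HodgeCM.PerL34.Spectral

section Koopman

variable {X : Type*} [MeasurableSpace X] {μ : Measure X}
variable {M : Type*} [Monoid M] [MulAction M X] [SMulInvariantMeasure M X μ] [MeasurableConstSMul M X]

variable (μ) in
/-- The Koopman operator of `c : Mᵈᵐᵃ` on `L²(X, μ)` (`f ↦ f ∘ (c • ·)`), a linear isometry. -/
def koopmanₗᵢ (c : Mᵈᵐᵃ) : Lp ℂ 2 μ →ₗᵢ[ℂ] Lp ℂ 2 μ where
  toFun f := c • f
  map_add' := smul_add c
  map_smul' a f := smul_comm c a f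
  norm_map' := DomMulAct.norm_smul_Lp c

/-- (Ported verbatim from the HodgeCMPerL package; no docstring in the source.) -/
@[simp] theorem koopmanₗᵢ_apply (c : Mᵈᵐᵃ) (f : Lp ℂ 2 μ) : koopmanₗᵢ μ c f = c • f := rfl

variable (μ) in
/-- **The Koopman (translation) representation** of `Mᵈᵐᵃ` on `L²(X, μ)` by bounded operators. -/
def koopman : Mᵈᵐᵃ →* (Lp ℂ 2 μ →L[ℂ] Lp ℂ 2 μ) where
  toFun c := (koopmanₗᵢ μ c).toContinuousLinearMap
  map_one' := by
    ext f
    simp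
  map_mul' a b := by
    ext f
    simp [mul_smul]

/-- (Ported verbatim from the HodgeCMPerL package; no docstring in the source.) -/
@[simp] theorem koopman_apply (c : Mᵈᵐᵃ) (f : Lp ℂ 2 μ) : koopman μ c f = c • f := rfl

end Koopman

section KoopmanGroup

variable {X : Type*} [MeasurableSpace X] {μ : Measure X}
variable {M : Type*} [Group M] [MulAction M X] [SMulInvariantMeasure M X μ] [MeasurableConstSMul M X]

/-- **`R_unitary` — PROVED** for the translation representation on `L²` of an invariant measure. -/
theorem isUnitaryRep_koopman : IsUnitaryRep (koopman μ (M := M)) :=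
  fun c u v => (koopmanₗᵢ μ c).inner_map_map u v

/-- Hence also a compact approximation of the Koopman representation gives its discrete decomposition outright. -/
theorem discreteDecomp_koopman (h : HasCompactApprox (koopman μ (M := M))) :
    (⨆ V : Irr (koopman μ (M := M)), (V.1 : Submodule ℂ (Lp ℂ 2 μ))).topologicalClosure = ⊤ :=
  discreteDecomp_of_compactApprox isUnitaryRep_koopman h

end KoopmanGroup

end RepDecomp

/-! ## The core carrier modelled on `L²` of an invariant measure -/

namespace RepCoreCarrier

variable {X : Type} [MeasurableSpace X] {μ : Measure X}
variable {M : Type} [Group M] [TopologicalSpace M] [MulAction M X] [SMulInvariantMeasure M X μ]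
  [MeasurableConstSMul M X]
variable {HG CG SK SigIdxG : Type}
variable [NormedAddCommGroup HG] [InnerProductSpace ℂ HG] [CompleteSpace HG]
variable [NormedAddCommGroup CG] [NormedSpace ℂ CG] [TopologicalSpace SK]
variable (C : RepCoreCarrier (Lp ℂ 2 μ) HG CG Mᵈᵐᵃ SK SigIdxG)

/-- **The analytic hypotheses of a core carrier ON `L²(X, μ)` WITH `R` THE TRANSLATION REPRESENTATION**: only the
compact approximation (Getz–Hahn Thm 9.1.1 + Dirac sequences, see `AnalyticK.compactApprox`) and the `G_U`-side
completeness remain; unitarity is a theorem (`RepDecomp.isUnitaryRep_koopman`). -/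
structure AnalyticL2 : Prop where
  /-- the representation IS the translation representation of `U(W)(𝔸)ᵈᵐᵃ` on `L²([U(W)], μ)` -/
  R_eq : C.R = RepDecomp.koopman μ
  /-- compact approximation (as in `AnalyticK`) -/
  compactApprox : RepDecomp.HasCompactApprox C.R
  /-- AX1b(a): completeness of the `G_U`-side decomposition (unchanged) -/
  hatτ_complete : (⨆ j, C.hatτ j).topologicalClosure = ⊤

variable {C}

/-- (Ported verbatim from the HodgeCMPerL package; no docstring in the source.) -/
theorem AnalyticL2.toAnalyticK (h : C.AnalyticL2) : C.AnalyticK where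
  R_unitary := by
    rw [h.R_eq]
    exact RepDecomp.isUnitaryRep_koopman
  compactApprox := h.compactApprox
  hatτ_complete := h.hatτ_complete

/-- (Ported verbatim from the HodgeCMPerL package; no docstring in the source.) -/
theorem AnalyticL2.toAnalytic (h : C.AnalyticL2) : C.Analytic :=
  h.toAnalyticK.toAnalytic

end RepCoreCarrier

end HodgeCM

end
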